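import Literature.NumberTheory.Automorphic.LocalOrderUnitIndex    -- ★ FILE 2∕3: O2 `index_range_units_map_eq_of_index_eq_pow` (brings ★ `LatticeIndexGL`: `IsUniformizingElement`, `natCard_quotient_span_pow`, `𝒪[F]`, `𝓀[F]`, `valuation F`)
import Literature.LinearAlgebra.FreeModule.DetQuotientDegree        -- ★ `associated_det_prod_smithNormalFormCoeffs` (Smith normal form over a PID: `det φ ∼ ∏ aᵢ`)
import Mathlib.LinearAlgebra.Vandermonde
import Mathlib.LinearAlgebra.Matrix.ToLinearEquiv
import Mathlib.Algebra.Polynomial.Inductions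
import HarnessLib

/-!
# The index of the monogenic order `𝒪[γ] ≤ 𝒪ⁿ` is `q^{Σ_{i<j} v(γ_j − γ_i)}` (Vandermonde), and its unit index — T3′ organs O1 «VANDERMONDE INDEX» and O1 ∘ O2
# (Neukirch, *Algebraic Number Theory*, Ch. I §12; Horn–Johnson §0.9.11; Stacks 02QG)

Topic `NumberTheory/Automorphic`; namespace `Literature.NumberTheory.Automorphic`.  THEOREMS ONLY (no definition, no instance, no notation, no named fact, no `sorry`); generic
`[Field F] [ValuativeRel F]` = (D0) ∕ ★ `FixedCosetsStableLattices` ∕ ★ `LatticeIndexGL` currency (`𝒪 = 𝒪[F]`, `𝓀 = 𝓀[F]`, `q = Nat.card 𝓀[F]`, `hϖ : IsUniformizingElement ϖ`), any `n`;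
§1 over any PID.  Cell `pub/hodgecm-mathlib` (D-0151), crux H413 = `stmt-HodgeConjecture-24833`; road «S3-tree» (LEAD F0P3a-plan (g11) T10-2 ∕ T10-15), brick T3′ «DEPTH-ZERO
κ-TRANSFER» (holder F0P3b-p01 (g11), DESIGN v1 419b4e54 §2), organs **O1** and **O1 ∘ O2** (architect A-p16 (g29) A-61 (1) ∕ A-62 (1) ∕ A-63 (2) → F0P3-p02 (g14); statement-first
heads 666ea884 «=» ref5 (g0) R-2).  HONEST LABEL: HC_CM is proved only modulo the printed citations (2 remaining named inputs hLiu418 24832, h413 24833) until rung 0 closes; this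
file is commutative∕linear algebra of orders in the split étale algebra `Fⁿ` and asserts nothing printed.

THE MATHEMATICS.  (§1, `R` a PID) For a square matrix `A` with `det A ≠ 0`, **`#(Rⁿ ⧸ ARⁿ) = #(R ⧸ det A)`**: Smith normal form `Rⁿ⧸ARⁿ ≅ ⊕ R⧸(aᵢ)` (Mathlib
`Submodule.quotientEquivPiSpan`), `det A ∼ ∏ aᵢ` (★ `associated_det_prod_smithNormalFormCoeffs`), and `#(R⧸(ab)) = #(R⧸(a))·#(R⧸(b))`.  (§2) The monogenic order `R[γ]` of
`γ : Fin n → R` — the `R`-span of the componentwise powers `γ^0, …, γ^{n−1}` — is the column lattice of the Vandermonde matrix `V(γ)`, so for `γ` pairwise distinct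
**`[Rⁿ : R[γ]] = #(R ⧸ ∏_{i<j}(γ_j − γ_i))`** (Mathlib `Matrix.det_vandermonde`).  (§3, (D0) currency) `Algebra.adjoin 𝒪 {γ}` IS that span (reduce modulo the monic `∏ (X − γ_i)`),
an element of valuation `v(ϖ)^N` generates `(ϖ^N)` with `#(𝒪⧸ϖ^N) = q^N` (★ `natCard_quotient_span_pow`), hence **O1: `[𝒪ⁿ : 𝒪[γ]] = q^S`, `S = Σ_{i<j} N i j`** when
`v(γ_j − γ_i) = v(ϖ)^{N i j}`.  (§4) Subalgebras of `𝒪ⁿ` are inverse-closed (Cayley–Hamilton: `x⁻¹ = −p(0)⁻¹·(divX p)(x)`, `p = ∏ (X − x_i)`), so a subalgebra whose elements have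
pairwise congruent coordinates mod `𝔪` is LOCAL; for a DEEP `γ` (`N i j ≥ 1`) this is `𝒪[γ]`, and ★ O2 (`LocalOrderUnitIndex.index_range_units_map_eq_of_index_eq_pow`) gives
**O1 ∘ O2: `[(𝒪^×)ⁿ : 𝒪[γ]^×] = (q − 1)^{n−1} q^{S−(n−1)}`** — DESIGN §1's `[𝒪_A^× : R₀^×] = (q_E² … )`: at `𝒪_E` (`q_E = q²`, `n = 3`) `(q²−1)² q^{2S−4}`, at `𝒪_F` on `R₀^σ`
(★ O3 `relIndex_inf_fixed_sq_eq_relIndex`) `(q−1)² q^{S−2}`, whose quotient `(q+1)² q^{S−2} = [C : R₀^×]` is ★ O4 `relIndex_comap_eq_of_index_eq`.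

* §1 `natCard_quotient_span_singleton_mul`, `natCard_quotient_span_singleton_prod`, `toLin'_injective_of_det_ne_zero'`, **`natCard_quotient_range_toLin'_eq_natCard_quotient_span_det`**.
* §2 `col_vandermonde`, `range_toLin'_vandermonde`, **`index_span_range_pow_eq_natCard_quotient_det_vandermonde`** (O1-gen).
* §3 `aeval_prod_X_sub_C_eq_zero`, `adjoin_singleton_toSubmodule_eq_span_range_pow`, `span_singleton_eq_span_uniformizer_pow_of_valuation_eq`,
  `natCard_quotient_span_singleton_of_valuation_eq`, **`index_adjoin_singleton_eq_pow_sum`** (O1).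
* §4 `exists_inv_mem_of_forall_isUnit`, `isLocalRing_toSubring_of_forall_sub_apply_mem`, `sub_apply_mem_maximalIdeal_of_mem_adjoin_singleton`, `mem_maximalIdeal_of_valuation_eq_pow`,
  **`index_range_units_map_adjoin_singleton_eq`** (O1 ∘ O2).

## References
* [Neukirch1999] J. Neukirch, *Algebraic Number Theory*, Grundlehren 322 (1999): Ch. I §12 (orders `𝒪 ⊆ 𝒪_K`, conductor, unit index `[𝒪_K^× : 𝒪^×]`).
* [HornJohnson2013] R. A. Horn, C. R. Johnson, *Matrix Analysis*, 2nd ed. (2013): §0.9.11 (Vandermonde matrices and `det V = ∏_{i<j}(x_j − x_i)`), Thm. 2.4.3.2 (Cayley–Hamilton), §0.5.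
* [StacksProject] The Stacks Project, Tag 02QG (length of the cokernel of an injective map of finite free modules = order of the determinant).
* [Macdonald1995] I. G. Macdonald, *Symmetric Functions and Hall Polynomials*, 2nd ed. (1995): Ch. II §1 (1.4) (`|𝔬⧸𝔭^m| = q^m`).
* [Hungerford1974] T. W. Hungerford, *Algebra*, GTM 73 (1974): Ch. IV Thm. 1.10 (isomorphism theorems for modules).
* [Rogawski1990] J. D. Rogawski, *Automorphic Representations of Unitary Groups in Three Variables* (1990): §4.9 Lemma 4.9.3 p. 56 (where the count is consumed).
-/

set_option autoImplicit false

noncomputable section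

open scoped ValuativeRel Matrix
open Matrix Finset ValuativeRel

namespace Literature.NumberTheory.Automorphic

/-! ## §1 Over a principal ideal domain: `#(Rⁿ ⧸ A Rⁿ) = #(R ⧸ det A)` -/

section PID

variable {R : Type*} [CommRing R] [IsDomain R]

/-- `#(R ⧸ (ab)) = #(R ⧸ (b)) · #(R ⧸ (a))` for `a ≠ 0` in a domain (`(a)⁄(ab) ≅ R⁄(b)` via `t ↦ at`; third isomorphism theorem). [cite: Hungerford1974, Ch. IV Thm. 1.10] -/
theorem natCard_quotient_span_singleton_mul (a b : R) (ha : a ≠ 0) :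
    Nat.card (R ⧸ Ideal.span ({a * b} : Set R)) = Nat.card (R ⧸ Ideal.span ({b} : Set R)) * Nat.card (R ⧸ Ideal.span ({a} : Set R)) := by
  set S : Submodule R R := Ideal.span {a} with hS
  set T : Submodule R R := Ideal.span {a * b} with hT
  have hTS : T ≤ S := Ideal.span_singleton_le_span_singleton.2 (dvd_mul_right a b)
  have h := Submodule.card_quotient_mul_card_quotient S T hTS
  -- `S / T = range (t ↦ a t mod T) ≅ R / (b)`
  have hrange : S.map T.mkQ = LinearMap.range (T.mkQ ∘ₗ LinearMap.toSpanSingleton R R a) := by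
    rw [LinearMap.range_comp, LinearMap.range_toSpanSingleton]
  have hker : LinearMap.ker (T.mkQ ∘ₗ LinearMap.toSpanSingleton R R a) = Ideal.span {b} := by
    ext t
    rw [LinearMap.mem_ker, LinearMap.comp_apply, LinearMap.toSpanSingleton_apply, Submodule.mkQ_apply,
      Submodule.Quotient.mk_eq_zero, hT, smul_eq_mul, Ideal.mem_span_singleton, Ideal.mem_span_singleton]
    constructor
    · rintro ⟨c, hc⟩
      exact ⟨c, mul_left_cancel₀ ha (by rw [← mul_assoc, ← hc, mul_comm])⟩
    · rintro ⟨c, rfl⟩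
      exact ⟨c, by ring⟩
  have hcardS : Nat.card (S.map T.mkQ) = Nat.card (R ⧸ Ideal.span ({b} : Set R)) := by
    rw [hrange, ← hker]
    exact (Nat.card_congr (LinearMap.quotKerEquivRange _).toEquiv).symm
  rw [← h, hcardS]

/-- `#(R ⧸ (∏ a_i)) = ∏ #(R ⧸ (a_i))` for non-zero `a_i` in a domain. [cite: Hungerford1974, Ch. IV Thm. 1.10] -/
theorem natCard_quotient_span_singleton_prod {ι : Type*} (s : Finset ι) (a : ι → R) (ha : ∀ i ∈ s, a i ≠ 0) :
    Nat.card (R ⧸ Ideal.span ({∏ i ∈ s, a i} : Set R)) = ∏ i ∈ s, Nat.card (R ⧸ Ideal.span ({a i} : Set R)) := by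
  classical
  induction s using Finset.induction_on with
  | empty =>
    rw [Finset.prod_empty, Finset.prod_empty, Ideal.span_singleton_one]
    haveI : Subsingleton (R ⧸ (⊤ : Submodule R R)) := Submodule.Quotient.subsingleton_iff.2 rfl
    exact Nat.card_of_subsingleton (0 : R ⧸ (⊤ : Submodule R R))
  | insert i s hi ih =>
    rw [Finset.prod_insert hi, Finset.prod_insert hi, natCard_quotient_span_singleton_mul _ _ (ha i (Finset.mem_insert_self i s)),
      ih (fun j hj => ha j (Finset.mem_insert_of_mem hj)), mul_comm]

variable {ι : Type*} [Fintype ι] [DecidableEq ι]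

/-- A square matrix with non-zero determinant over a domain acts injectively on `Rⁿ` (Mathlib `Matrix.exists_mulVec_eq_zero_iff`; the `ℤ_p` twin is ★
`Literature.LinearAlgebra.FreeModule.toLin'_injective_of_det_ne_zero`). [cite: HornJohnson2013, §0.5 (nonsingularity)] -/
theorem toLin'_injective_of_det_ne_zero' (A : Matrix ι ι R) (hA : A.det ≠ 0) : Function.Injective (Matrix.toLin' A) := by
  rw [← LinearMap.ker_eq_bot, LinearMap.ker_eq_bot']
  intro v hv
  by_contra hv0
  exact hA (Matrix.exists_mulVec_eq_zero_iff.mp ⟨v, hv0, by simpa using hv⟩)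

variable [IsPrincipalIdealRing R]

/-- **`#(Rⁿ ⧸ A Rⁿ) = #(R ⧸ det A)`** for a square matrix `A` with `det A ≠ 0` over a principal ideal domain: Smith normal form `Rⁿ ⧸ ARⁿ ≅ ⊕ R⧸(a_i)` (Mathlib
`Submodule.quotientEquivPiSpan`) with `det A ∼ ∏ a_i` (★ `Literature.LinearAlgebra.FreeModule.associated_det_prod_smithNormalFormCoeffs`) and `#(R⧸∏ a_i) = ∏ #(R⧸a_i)`.
[cite: StacksProject, Tag 02QG] -/
theorem natCard_quotient_range_toLin'_eq_natCard_quotient_span_det (A : Matrix ι ι R) (hA : A.det ≠ 0) :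
    Nat.card ((ι → R) ⧸ LinearMap.range (Matrix.toLin' A)) = Nat.card (R ⧸ Ideal.span ({A.det} : Set R)) := by
  classical
  set φ := Matrix.toLin' A
  have hφ : Function.Injective φ := toLin'_injective_of_det_ne_zero' A hA
  have h := LinearMap.finrank_range_of_inj hφ
  have hne := fun i => Submodule.smithNormalFormCoeffs_ne_zero (Pi.basisFun R ι) h i
  have hassoc := Literature.LinearAlgebra.FreeModule.associated_det_prod_smithNormalFormCoeffs (Pi.basisFun R ι) φ hφ h
  rw [LinearMap.det_toLin'] at hassoc
  rw [Nat.card_congr ((LinearMap.range φ).quotientEquivPiSpan (Pi.basisFun R ι) h).toEquiv, Nat.card_pi,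
    Ideal.span_singleton_eq_span_singleton.2 hassoc, natCard_quotient_span_singleton_prod _ _ fun i _ => hne i]

end PID

/-! ## §2 The Vandermonde lattice = the monogenic order `R[γ]` -/

section Vandermonde

variable {R : Type*} [CommRing R] {n : ℕ}

/-- The `j`-th column of the Vandermonde matrix of `γ` is the componentwise power `γ^j`. [cite: HornJohnson2013, §0.9.11] -/
theorem col_vandermonde (γ : Fin n → R) (j : Fin n) : (Matrix.vandermonde γ).col j = γ ^ (j : ℕ) := by
  funext i
  simp [Matrix.col, Matrix.vandermonde_apply]

/-- The column span of the Vandermonde matrix of `γ` is the `R`-span of the componentwise powers `γ^0, …, γ^{n−1}` — the monogenic order `R[γ] ≤ Rⁿ` as a lattice.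
[cite: HornJohnson2013, §0.9.11] -/
theorem range_toLin'_vandermonde (γ : Fin n → R) :
    LinearMap.range (Matrix.toLin' (Matrix.vandermonde γ)) = Submodule.span R (Set.range fun j : Fin n => γ ^ (j : ℕ)) := by
  rw [Matrix.range_toLin']
  rfl

/-- **O1-gen «VANDERMONDE INDEX» over a principal ideal domain.**  For `γ : Fin n → R` pairwise distinct, the `R`-span of the componentwise powers `γ^0, …, γ^{n−1}`
has additive index `#(R ⧸ det V(γ))` in `Rⁿ`, `det V(γ) = ∏_{i<j} (γ_j − γ_i)` (Mathlib `Matrix.det_vandermonde`).  (The heads file 666ea884 stated this layer over any domain; it is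
cut here over a PID, which is what the (D0) currency consumes.) [cite: HornJohnson2013, §0.9.11] [cite: StacksProject, Tag 02QG] -/
theorem index_span_range_pow_eq_natCard_quotient_det_vandermonde [IsDomain R] [IsPrincipalIdealRing R]
    (γ : Fin n → R) (hγ : Function.Injective γ) :
    (Submodule.span R (Set.range fun j : Fin n => γ ^ (j : ℕ))).toAddSubgroup.index =
      Nat.card (R ⧸ Ideal.span ({(Matrix.vandermonde γ).det} : Set R)) := by
  classical
  rw [← range_toLin'_vandermonde, ← natCard_quotient_range_toLin'_eq_natCard_quotient_span_det _
    (Matrix.det_vandermonde_ne_zero_iff.2 hγ)]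
  rfl

end Vandermonde

/-! ## §3 (D0) currency — O1: `[𝒪ⁿ : 𝒪[γ]] = q^{Σ_{i<j} v(γ_j − γ_i)}` -/

section DVR

variable {F : Type*} [Field F] [ValuativeRel F] {n : ℕ}

/-- `x ∈ 𝒪ⁿ` is killed by the monic `∏_i (X − x_i)` of degree `n` (componentwise Cayley–Hamilton for the diagonal algebra). [cite: HornJohnson2013, Thm. 2.4.3.2] -/
theorem aeval_prod_X_sub_C_eq_zero (γ : Fin n → 𝒪[F]) :
    Polynomial.aeval γ (∏ i : Fin n, (Polynomial.X - Polynomial.C (γ i))) = 0 := by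
  funext k
  rw [map_prod, Finset.prod_apply, Pi.zero_apply]
  exact Finset.prod_eq_zero (Finset.mem_univ k) (by simp)

/-- **The monogenic order `𝒪[γ] = Algebra.adjoin 𝒪 {γ}` IS the `𝒪`-span of `γ^0, …, γ^{n−1}`**: reduce any polynomial in `γ` modulo the monic `∏ (X − γ_i)` of degree `n`
(Mathlib `Polynomial.modByMonic_add_div`, `natDegree_modByMonic_lt`, `aeval_eq_sum_range'`). [cite: Neukirch1999, Ch. I §12] [cite: HornJohnson2013, Thm. 2.4.3.2] -/
theorem adjoin_singleton_toSubmodule_eq_span_range_pow (γ : Fin n → 𝒪[F]) :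
    Subalgebra.toSubmodule (Algebra.adjoin 𝒪[F] ({γ} : Set (Fin n → 𝒪[F]))) =
      Submodule.span 𝒪[F] (Set.range fun j : Fin n => γ ^ (j : ℕ)) := by
  classical
  set p : Polynomial 𝒪[F] := ∏ i : Fin n, (Polynomial.X - Polynomial.C (γ i)) with hp
  have hpm : p.Monic := Polynomial.monic_prod_of_monic _ _ fun i _ => Polynomial.monic_X_sub_C (γ i)
  have hpdeg : p.natDegree = n := by
    rw [hp, Polynomial.natDegree_prod_of_monic _ _ fun i _ => Polynomial.monic_X_sub_C (γ i)]
    simp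
  have hp0 : Polynomial.aeval γ p = 0 := aeval_prod_X_sub_C_eq_zero γ
  apply le_antisymm
  · intro x hx
    rw [Subalgebra.mem_toSubmodule, Algebra.adjoin_singleton_eq_range_aeval, AlgHom.mem_range] at hx
    obtain ⟨f, rfl⟩ := hx
    rcases Nat.eq_zero_or_pos n with hn | hn
    · subst hn
      have : (Polynomial.aeval γ f : Fin 0 → 𝒪[F]) = 0 := Subsingleton.elim _ _
      rw [this]; exact Submodule.zero_mem _
    · have hp1 : p ≠ 1 := by intro h; rw [h, Polynomial.natDegree_one] at hpdeg; omega
      have hf : Polynomial.aeval γ f = Polynomial.aeval γ (f %ₘ p) := by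
        conv_lhs => rw [← Polynomial.modByMonic_add_div f p]
        rw [map_add, map_mul, hp0, zero_mul, add_zero]
      have hlt : (f %ₘ p).natDegree < n := hpdeg ▸ Polynomial.natDegree_modByMonic_lt f hpm hp1
      rw [hf, Polynomial.aeval_eq_sum_range' hlt]
      exact Submodule.sum_mem _ fun j hj => Submodule.smul_mem _ _ (Submodule.subset_span ⟨⟨j, Finset.mem_range.1 hj⟩, rfl⟩)
  · rw [Submodule.span_le]
    rintro _ ⟨j, rfl⟩
    rw [SetLike.mem_coe, Subalgebra.mem_toSubmodule]
    exact Subalgebra.pow_mem _ (Algebra.self_mem_adjoin_singleton 𝒪[F] γ) _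

variable {ϖ : F} (hϖ : IsUniformizingElement ϖ)
include hϖ

/-- An element of `𝒪` of valuation `v(ϖ)^N` generates the ideal `(ϖ^N)` (`x ∕ ϖ^N` has valuation `1`, hence is a unit of `𝒪`). [cite: Macdonald1995, Ch. II §1 (1.4)] -/
theorem span_singleton_eq_span_uniformizer_pow_of_valuation_eq {x : 𝒪[F]} {N : ℕ}
    (hx : valuation F (x : F) = valuation F ϖ ^ N) :
    Ideal.span ({x} : Set 𝒪[F]) = Ideal.span {(⟨ϖ, hϖ.mem⟩ : 𝒪[F]) ^ N} := by
  have hv0 : valuation F ϖ ≠ 0 := (Valuation.ne_zero_iff _).2 hϖ.ne_zero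
  have hϖN : (ϖ : F) ^ N ≠ 0 := pow_ne_zero _ hϖ.ne_zero
  have hu1 : valuation F ((x : F) / ϖ ^ N) = 1 := by
    rw [map_div₀, map_pow, hx, div_self (pow_ne_zero _ hv0)]
  have humem : (x : F) / ϖ ^ N ∈ 𝒪[F] := by
    rw [Valuation.mem_integer_iff, hu1]
  set u : 𝒪[F] := ⟨(x : F) / ϖ ^ N, humem⟩ with hudef
  have hu : IsUnit u := (Valuation.integer.integers (valuation F)).isUnit_iff_valuation_eq_one.2 hu1
  have hxu : x = (⟨ϖ, hϖ.mem⟩ : 𝒪[F]) ^ N * u := by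
    apply Subtype.ext
    change (x : F) = ϖ ^ N * ((x : F) / ϖ ^ N)
    rw [mul_div_cancel₀ _ hϖN]
  rw [Ideal.span_singleton_eq_span_singleton]
  exact ⟨hu.unit⁻¹, by rw [hxu, mul_assoc, IsUnit.mul_val_inv, mul_one]⟩

/-- `#(𝒪 ⧸ (x)) = q^N` for `x ∈ 𝒪` of valuation `v(ϖ)^N` (★ `natCard_quotient_span_pow`). [cite: Macdonald1995, Ch. II §1 (1.4)] -/
theorem natCard_quotient_span_singleton_of_valuation_eq {x : 𝒪[F]} {N : ℕ}
    (hx : valuation F (x : F) = valuation F ϖ ^ N) :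
    Nat.card (𝒪[F] ⧸ Ideal.span ({x} : Set 𝒪[F])) = Nat.card 𝓀[F] ^ N := by
  rw [span_singleton_eq_span_uniformizer_pow_of_valuation_eq hϖ hx, natCard_quotient_span_pow hϖ N]

/-- **O1 «VANDERMONDE INDEX» (DESIGN v1 §2, (D0) currency).**  `𝒪 = 𝒪[F]` the valuation ring (a DVR, so a PID), `q = #𝓀[F]`, `ϖ` a uniformizer, `γ : Fin n → 𝒪` with
`v(γ_j − γ_i) = v(ϖ)^{N i j}` for `i < j` (so `γ` is pairwise distinct): **`[𝒪ⁿ : 𝒪[γ]] = q^S`, `S = Σ_{i<j} N i j`** — the additive index of the monogenic order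
`Algebra.adjoin 𝒪 {γ}` in the maximal order `𝒪ⁿ` of the split étale algebra `Fⁿ = F[γ]`.  (`[Finite 𝓀[F]]` of the heads file is not needed.) [cite: Neukirch1999, Ch. I §12]
[cite: HornJohnson2013, §0.9.11] -/
theorem index_adjoin_singleton_eq_pow_sum [IsDiscreteValuationRing 𝒪[F]]
    (γ : Fin n → 𝒪[F]) (N : Fin n → Fin n → ℕ)
    (hN : ∀ i j : Fin n, i < j → valuation F (((γ j : F) - γ i)) = valuation F ϖ ^ N i j) :
    (Algebra.adjoin 𝒪[F] ({γ} : Set (Fin n → 𝒪[F]))).toSubring.toAddSubgroup.index =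
      Nat.card 𝓀[F] ^ (∑ i : Fin n, ∑ j ∈ Ioi i, N i j) := by
  classical
  have hv0 : valuation F ϖ ≠ 0 := (Valuation.ne_zero_iff _).2 hϖ.ne_zero
  have hne : ∀ i j : Fin n, i < j → γ i ≠ γ j := by
    intro i j hij heq
    have h := hN i j hij
    rw [heq, sub_self, map_zero] at h
    exact pow_ne_zero _ hv0 h.symm
  have hγ : Function.Injective γ := by
    intro i j hij
    by_contra hij'
    rcases lt_or_gt_of_ne hij' with h | h
    · exact hne i j h hij
    · exact hne j i h hij.symm
  have h1 : (Algebra.adjoin 𝒪[F] ({γ} : Set (Fin n → 𝒪[F]))).toSubring.toAddSubgroup =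
      (Submodule.span 𝒪[F] (Set.range fun j : Fin n => γ ^ (j : ℕ))).toAddSubgroup := by
    rw [← adjoin_singleton_toSubmodule_eq_span_range_pow]; rfl
  rw [h1, index_span_range_pow_eq_natCard_quotient_det_vandermonde γ hγ, Matrix.det_vandermonde]
  apply natCard_quotient_span_singleton_of_valuation_eq hϖ
  have hcoe : ((∏ i : Fin n, ∏ j ∈ Ioi i, (γ j - γ i) : 𝒪[F]) : F) = ∏ i : Fin n, ∏ j ∈ Ioi i, ((γ j : F) - γ i) := by
    change (valuation F).integer.subtype _ = _
    simp only [map_prod, map_sub, Subring.coe_subtype]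
  rw [hcoe, map_prod, ← Finset.prod_pow_eq_pow_sum]
  refine Finset.prod_congr rfl fun i _ => ?_
  rw [map_prod, ← Finset.prod_pow_eq_pow_sum]
  exact Finset.prod_congr rfl fun j hj => hN i j (Finset.mem_Ioi.1 hj)

end DVR

/-! ## §4 Locality of `𝒪[γ]` for a deep `γ`, and O1 ∘ O2: its unit index -/

section UnitIndex

variable {F : Type*} [Field F] [ValuativeRel F] {n : ℕ}

/-- **Subalgebras of `𝒪ⁿ` are inverse-closed**: if `x ∈ S` has unit coordinates then `x⁻¹ ∈ S` — from `X·divX p + C(p(0)) = p = ∏ (X − x_i)` with `p(0) = ∏(−x_i)` a unit,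
`x⁻¹ = −p(0)⁻¹ · (divX p)(x) ∈ 𝒪[x] ⊆ S`. [cite: HornJohnson2013, Thm. 2.4.3.2] -/
theorem exists_inv_mem_of_forall_isUnit (S : Subalgebra 𝒪[F] (Fin n → 𝒪[F])) {x : Fin n → 𝒪[F]} (hx : x ∈ S)
    (hu : ∀ i, IsUnit (x i)) : ∃ y ∈ S, x * y = 1 := by
  classical
  set p : Polynomial 𝒪[F] := ∏ i : Fin n, (Polynomial.X - Polynomial.C (x i)) with hp
  have hp0 : Polynomial.aeval x p = 0 := aeval_prod_X_sub_C_eq_zero x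
  -- the constant coefficient is a unit
  have hc : IsUnit (p.coeff 0) := by
    rw [Polynomial.coeff_zero_eq_eval_zero, hp, Polynomial.eval_prod]
    refine IsUnit.prod_univ_iff.2 fun i => ?_
    rw [Polynomial.eval_sub, Polynomial.eval_X, Polynomial.eval_C, zero_sub]
    exact (hu i).neg
  obtain ⟨c, hcu⟩ := hc
  -- `x · aeval x (divX p) + c = 0`
  have key : x * Polynomial.aeval x p.divX + algebraMap 𝒪[F] (Fin n → 𝒪[F]) (p.coeff 0) = 0 := by
    have := congrArg (Polynomial.aeval x) (Polynomial.X_mul_divX_add p)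
    rwa [map_add, map_mul, Polynomial.aeval_X, Polynomial.aeval_C, hp0] at this
  refine ⟨-(algebraMap 𝒪[F] (Fin n → 𝒪[F]) ((c⁻¹ : (𝒪[F])ˣ) : 𝒪[F]) * Polynomial.aeval x p.divX), ?_, ?_⟩
  · refine S.neg_mem (S.mul_mem (S.algebraMap_mem _) ?_)
    exact Algebra.adjoin_le (Set.singleton_subset_iff.2 hx) (Polynomial.aeval_mem_adjoin_singleton _ _)
  · have h1 : x * Polynomial.aeval x p.divX = -algebraMap 𝒪[F] (Fin n → 𝒪[F]) (c : 𝒪[F]) := by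
      rw [hcu]; exact eq_neg_of_add_eq_zero_left key
    rw [mul_neg, mul_left_comm, h1, mul_neg, neg_neg, ← map_mul, Units.inv_mul, map_one]

/-- **Locality criterion**: a subalgebra `S ≤ 𝒪ⁿ` (`n ≥ 1`) all of whose elements have pairwise congruent coordinates modulo `𝔪` is a LOCAL ring — for `x ∈ S` either every
coordinate is a unit (then `x ∈ S^×` by inverse-closedness) or every coordinate lies in `𝔪` (then `1 − x ∈ S^×`). [cite: Neukirch1999, Ch. I §12] -/
theorem isLocalRing_toSubring_of_forall_sub_apply_mem (S : Subalgebra 𝒪[F] (Fin n → 𝒪[F])) (hn : 0 < n)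
    (hS : ∀ x ∈ S, ∀ i j : Fin n, x i - x j ∈ IsLocalRing.maximalIdeal 𝒪[F]) : IsLocalRing S.toSubring := by
  haveI : Nontrivial S.toSubring := by
    refine ⟨⟨0, 1, fun h => ?_⟩⟩
    have := congrArg (fun z : S.toSubring => (z : Fin n → 𝒪[F]) ⟨0, hn⟩) h
    simp at this
  refine IsLocalRing.of_isUnit_or_isUnit_one_sub_self fun x => ?_
  have hxS : (x : Fin n → 𝒪[F]) ∈ S := x.2
  -- either all coordinates are units or all lie in `𝔪`
  by_cases h0 : IsUnit ((x : Fin n → 𝒪[F]) ⟨0, hn⟩)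
  · left
    have hall : ∀ i, IsUnit ((x : Fin n → 𝒪[F]) i) := by
      intro i
      by_contra hni
      have hmi : (x : Fin n → 𝒪[F]) i ∈ IsLocalRing.maximalIdeal 𝒪[F] := (IsLocalRing.mem_maximalIdeal _).2 hni
      have h0m : (x : Fin n → 𝒪[F]) ⟨0, hn⟩ ∈ IsLocalRing.maximalIdeal 𝒪[F] := by
        have := Ideal.add_mem _ (hS _ hxS ⟨0, hn⟩ i) hmi
        rwa [sub_add_cancel] at this
      exact (IsLocalRing.mem_maximalIdeal _ |>.1 h0m) h0
    obtain ⟨y, hyS, hxy⟩ := exists_inv_mem_of_forall_isUnit S hxS hall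
    exact ⟨⟨x, ⟨y, hyS⟩, Subtype.ext hxy, Subtype.ext (by rw [mul_comm] at hxy; exact hxy)⟩, rfl⟩
  · right
    have h0m : (x : Fin n → 𝒪[F]) ⟨0, hn⟩ ∈ IsLocalRing.maximalIdeal 𝒪[F] := (IsLocalRing.mem_maximalIdeal _).2 h0
    have hall : ∀ i, IsUnit ((1 - (x : Fin n → 𝒪[F])) i) := by
      intro i
      have hmi : (x : Fin n → 𝒪[F]) i ∈ IsLocalRing.maximalIdeal 𝒪[F] := by
        have := Ideal.sub_mem _ h0m (hS _ hxS ⟨0, hn⟩ i)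
        rwa [sub_sub_cancel] at this
      rw [Pi.sub_apply, Pi.one_apply]
      exact IsLocalRing.isUnit_one_sub_self_of_mem_nonunits _ ((IsLocalRing.mem_maximalIdeal _).1 hmi)
    have h1S : (1 - (x : Fin n → 𝒪[F])) ∈ S := S.sub_mem S.one_mem hxS
    obtain ⟨y, hyS, hxy⟩ := exists_inv_mem_of_forall_isUnit S h1S hall
    exact ⟨⟨1 - x, ⟨y, hyS⟩, Subtype.ext hxy, Subtype.ext (by rw [mul_comm] at hxy; exact hxy)⟩, rfl⟩

/-- If all `γ_i ≡ γ_j (mod 𝔪)` then every element of `𝒪[γ]` has pairwise congruent coordinates (induction on `Algebra.adjoin`). [cite: Neukirch1999, Ch. I §12] -/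
theorem sub_apply_mem_maximalIdeal_of_mem_adjoin_singleton {γ : Fin n → 𝒪[F]}
    (hγ : ∀ i j : Fin n, γ i - γ j ∈ IsLocalRing.maximalIdeal 𝒪[F]) {x : Fin n → 𝒪[F]}
    (hx : x ∈ Algebra.adjoin 𝒪[F] ({γ} : Set (Fin n → 𝒪[F]))) (i j : Fin n) :
    x i - x j ∈ IsLocalRing.maximalIdeal 𝒪[F] := by
  induction hx using Algebra.adjoin_induction generalizing i j with
  | mem y hy => rw [Set.mem_singleton_iff] at hy; subst hy; exact hγ i j
  | algebraMap r => simp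
  | add y z _ _ hy hz =>
    have : (y + z) i - (y + z) j = (y i - y j) + (z i - z j) := by simp only [Pi.add_apply]; ring
    rw [this]; exact Ideal.add_mem _ (hy i j) (hz i j)
  | mul y z _ _ hy hz =>
    have : (y * z) i - (y * z) j = y i * (z i - z j) + (y i - y j) * z j := by simp only [Pi.mul_apply]; ring
    rw [this]; exact Ideal.add_mem _ (Ideal.mul_mem_left _ _ (hz i j)) (Ideal.mul_mem_right _ _ (hy i j))

variable {ϖ : F} (hϖ : IsUniformizingElement ϖ)
include hϖ

/-- An element of valuation `v(ϖ)^N`, `N ≥ 1`, lies in `𝔪`. [cite: Macdonald1995, Ch. II §1 (1.4)] -/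
theorem mem_maximalIdeal_of_valuation_eq_pow {x : 𝒪[F]} {N : ℕ} (hN : 0 < N)
    (hx : valuation F (x : F) = valuation F ϖ ^ N) : x ∈ IsLocalRing.maximalIdeal 𝒪[F] := by
  rw [IsLocalRing.mem_maximalIdeal, mem_nonunits_iff,
    (Valuation.integer.integers (valuation F)).isUnit_iff_valuation_eq_one]
  change valuation F (x : F) ≠ 1
  rw [hx]
  exact (pow_lt_one₀ zero_le hϖ.valuation_lt_one hN.ne').ne

/-- **O1 ∘ O2 — THE UNIT INDEX OF THE MONOGENIC ORDER OF A DEEP REGULAR `γ`** (the number O4 ∕ O7 divide, DESIGN v1 §1 `[𝒪_A^× : R₀^×] = q_E^{S−n+1}(q_E − 1)^{n−1}`):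
for `n ≥ 1`, `γ : Fin n → 𝒪` with `v(γ_j − γ_i) = v(ϖ)^{N i j}`, `N i j ≥ 1` (`i < j`) — so `𝒪[γ]` is LOCAL (`isLocalRing_toSubring_of_forall_sub_apply_mem`) of index `q^S`
(O1) — **`[(𝒪^×)ⁿ : 𝒪[γ]^×] = (q − 1)^{n−1} q^{S−(n−1)}`**, `S = Σ_{i<j} N i j` (★ O2 `index_range_units_map_eq_of_index_eq_pow`). [cite: Neukirch1999, Ch. I §12]
[cite: Rogawski1990, §4.9 Lemma 4.9.3 p. 56] -/
theorem index_range_units_map_adjoin_singleton_eq [IsDiscreteValuationRing 𝒪[F]] [Finite 𝓀[F]]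
    (hn : 0 < n) (γ : Fin n → 𝒪[F]) (N : Fin n → Fin n → ℕ) (hNpos : ∀ i j : Fin n, i < j → 0 < N i j)
    (hN : ∀ i j : Fin n, i < j → valuation F (((γ j : F) - γ i)) = valuation F ϖ ^ N i j) :
    (Units.map ((Algebra.adjoin 𝒪[F] ({γ} : Set (Fin n → 𝒪[F]))).toSubring.subtype :
        (Algebra.adjoin 𝒪[F] ({γ} : Set (Fin n → 𝒪[F]))).toSubring →* (Fin n → 𝒪[F]))).range.index =
      (Nat.card 𝓀[F] - 1) ^ (n - 1) * Nat.card 𝓀[F] ^ ((∑ i : Fin n, ∑ j ∈ Ioi i, N i j) - (n - 1)) := by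
  set A := Algebra.adjoin 𝒪[F] ({γ} : Set (Fin n → 𝒪[F])) with hA
  have hγ : ∀ i j : Fin n, γ i - γ j ∈ IsLocalRing.maximalIdeal 𝒪[F] := by
    intro i j
    rcases lt_trichotomy i j with h | rfl | h
    · have := mem_maximalIdeal_of_valuation_eq_pow hϖ (hNpos i j h) (x := γ j - γ i) (by push_cast; exact hN i j h)
      rw [← neg_sub]; exact (Ideal.neg_mem_iff _).2 this
    · simp
    · exact mem_maximalIdeal_of_valuation_eq_pow hϖ (hNpos j i h) (x := γ i - γ j) (by push_cast; exact hN j i h)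
  haveI : IsLocalRing A.toSubring :=
    isLocalRing_toSubring_of_forall_sub_apply_mem A hn fun x hx i j => sub_apply_mem_maximalIdeal_of_mem_adjoin_singleton hγ hx i j
  have hconst : ∀ a : 𝒪[F], (fun _ : Fin n => a) ∈ A.toSubring := fun a => A.algebraMap_mem a
  exact (index_range_units_map_eq_of_index_eq_pow A.toSubring hconst (index_adjoin_singleton_eq_pow_sum hϖ γ N hN)).2

end UnitIndex

end Literature.NumberTheory.Automorphic

end
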